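import Summits.QuantumFields.BalabanUV.Beta.GAN24.ScaleNesting
import Summits.QuantumFields.BalabanUV.Beta.GAN24.TaylorBlockSum

/-!
# `BalabanUV.Beta.GAN24.SandwichDecimate` — binder row G-an2-4 / (CONV-C), S-slot («E3Shape» ∧ «E3SupRate»), road «S3-Taylor»: generic leaf
# «SANDWICH-DECIMATE*» under RATE row **R3-dL**, part 1 of 2 — THE AVERAGING LIFT OF THE TABLE IS ADJOINT TO THE BLOCK-CONTOUR DECIMATION OF THE
# OUTER LEGS, INSIDE `TaylorSandwich.sandwich_bound`'s LITERAL NESTING (unit `b2b-balaban-gan24-formalise-leaf-04`, gen 20; INTENT «SANDWICH-DECIMATE*»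
# CLAIMS l.5485; design fact (1) of leaf-08-g11's NOTE l.5351; interface = the R3-dL holder leaf-11-g15's «WRITE IT» l.5446 (a)(b)(c))

NOT IN PRINT; OUR BOOKKEEPING.  HONEST FRAMING (cell contract, verbatim): «discharging `BetaPertH` makes Bałaban's UV stability UNCONDITIONAL —
a real constructive-QFT result; it is NOT the continuum limit and NOT the Clay problem.»  HONEST DEPENDENCY (verbatim): «continuum YM on T⁴ ⇐
BetaPertH ∧ nine spine estimates (0/9 proved); BetaPertH ⇐ (D1) ∧ (D4) ∧ CAP+tail; G-an2-4 gates asym, D1 and NE2/3/4.»  [folklore] lattice-sum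
bookkeeping over an2's TYPED scale maps BY NAME (`InterLevelTransport.avgLift`∕`legOff`∕`legPt_eq_add_legOff`∕`tsum_sublattice`∕`summable_sublattice`∕
`eq_zsmul_quo_add_off`, `OneStepKernelFamily.legSet`∕`legPt`∕`legW`∕`legW_nonneg`∕`sum_legW`∕`legPt_add`, leaf-05's `ScaleNesting.quo_mul`∕`natCast_mul_smul`,
leaf-04's `TaylorBlockSum.nonneg_of_dominated`); generic `d`; ONE plumbing `def` (`decLeg`, the decimated outer leg — a finite weighted sum, asserting
nothing); 0 cite, 0 `def … : Prop`, no estimate of (N1)∕(N1-Cauchy)∕the K-slot, nothing asserted of Bałaban's objects; NOTHING of (hS, hSall)∕«E3Shape»∕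
«E3SupRate» discharged; moves no row by itself.  NOT summit progress; NOT BetaPertH, NOT continuum, NOT Clay.

## WHY (locator, not a premise)
The RATE row R3-dL of `StencilSlotE3RateOfPieces.e3SupRate_of_pieces` compares member `n+3`'s level-`(m+2)` Λ sandwich with member `n+2`'s
level-`(m+1)` one.  After `TaylorRowLamInner.inner_eq` both are one-channel unit sandwiches in the literal nesting of `TaylorSandwich.sandwich_bound`
(outer legs `A`, `B`, vertex leg `onLat N′ (ψ μ)`, table `onLat N′ (fun Y => avgLift M (K μ Y))`), and member `n+3`'s table is member `n+2`'s table
LIFTED ONE SCALE: `avgLift (P·M) = avgLift P ∘ avgLift M` (`ScaleNesting.avgLift_avgLift`).  Unfolding the outer `avgLift P` and re-indexing the two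
outer lattice sums residue class by residue class moves the lift onto the legs: the big member's sandwich IS the small member's sandwich read against the
`P`-DECIMATED outer legs `decLeg P A`, `decLeg P B` (weights = the contour multiplicities `legW`, total weight 1), up to the volume factor `P^{−(d+1)}` —
an IDENTITY, no weight-defect term, no Fubini beyond finitely many summable pieces.  The row holder then telescopes three such sandwiches.

## CONTENTS ([folklore]; `Site (d+1) = Fin (d+1) → ℤ`, `quo N` the block index, field legs `Sum.inl l` only)
§1 `decLeg P f` (def), `decLeg_shift` (the `z ↦ z − N•z′` rule across scales), `l1_quo_legPt_sub_quo_le` (a `P`-leg point over `w̄` lies in the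
   `N`-block of `w̄` or its `e_l`-neighbour, seen at blocking `P·N`), the block-decay TRANSFERS `abs_leg_transfer`∕`abs_leg_transfer'` (one leg point)
   and `abs_decLeg_le`∕`abs_decLeg_le'` (the decimated leg: constant `× e^{κ}`, same rate, blocking `P·N ↦ N`; both orientations).
§3 **`lift_adjoint_decLeg`** — THE ADJOINTNESS for a generic fine table `S : MKer` (the sandwich analogue of `InterLevelTransport.tadpole_avgLift`):
   `Σ'_y Σ_{l′} (Σ'_w Σ_l A l w · avgLift P S w y l l′) · B l′ y = Σ'_ȳ Σ_{l′} (Σ'_w̄ Σ_l decLeg P A l w̄ · S w̄ ȳ l l′) · decLeg P B l′ ȳ`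
   under summability of the finitely many residue-class pieces (hypotheses `hW`, `hY`, stated on the SMALL side).
Part 2 (`GAN24/SandwichDecimateVertex`): §2 the lift versus superpositions of the kernel and §4 the literal interface `sandwich_decimate`∕
`sandwich_decimate_avgLift` (+ `_of_legs` forms from `TaylorSandwich.sandwich_bound`'s own hypothesis list, + the bound `abs_sandwich_decimate_le`).
-/

noncomputable section

open Finset
open scoped BigOperators
open Literature.MathematicalPhysics.QuantumFieldTheory
open Literature.MathematicalPhysics.QuantumFieldTheory.Balaban1983to89
open Literature.MathematicalPhysics.QuantumFieldTheory.Balaban1983to89.Beta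
open Literature.Probability.LatticeModels (Torus.proj)
open AffineAveraging (Site)
open B12Sec2to5 (l1 l1_nonneg)
open ExpKernelCalculus (MKer l1_sub_symm l1_sub_triangle)
open LatticeForm (quo)
open BlochFibreUniqueness (quo_add_zsmul)
open OneStepResolventKernel (Fib proj_zsmul quo_zsmul eq_zsmul_quo_of_proj)
open OneStepKernelFamily (legSet legPt legW LegIdx legW_nonneg sum_legW legPt_add)
open InterLevelTransport (avgLift legOff legPt_eq_add_legOff tsum_sublattice summable_sublattice eq_zsmul_quo_add_off)
open Summit.QuantumFields.BalabanUV.Beta.GAN24.ScaleNesting (quo_mul natCast_mul_smul)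
open Summit.QuantumFields.BalabanUV.Beta.GAN24.TaylorBlockSum (nonneg_of_dominated)

namespace Summit.QuantumFields.BalabanUV.Beta.GAN24.SandwichDecimate

variable {d : ℕ}

/-! ## §1 The decimated outer leg and its block-decay transfer -/

section DecLeg

/-- [folklore] **THE `P`-DECIMATED OUTER LEG** (plumbing def, asserts nothing): a field leg `f l` on the FINE lattice read through the
linearised block-contour averaging of the factor `P` — at the coarse point `w` it is the `legW`-weighted sum (weights `P^{−(d+2)}`, total
weight `1`) of `f l` over the `P^{d+2}` points `P•w + r + s e_l` of the straight contours of the `P`-block at `P•w` in the leg direction `l`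
(the same leg sets ∕ points ∕ weights as `OneStepKernelFamily.dec` and `InterLevelTransport.avgLift`).  First `Fin` argument = the field-leg direction. -/
def decLeg (P : ℕ) (f : Fin (d + 1) → Site (d + 1) → ℝ) : Fin (d + 1) → Site (d + 1) → ℝ :=
  fun l w => ∑ i ∈ legSet d P (Sum.inl l), legW d P (Sum.inl l) * f l (legPt P (Sum.inl l) w i)

/-- [folklore] Unfolding `decLeg`. -/
theorem decLeg_apply (P : ℕ) (f : Fin (d + 1) → Site (d + 1) → ℝ) (l : Fin (d + 1)) (w : Site (d + 1)) :
    decLeg P f l w = ∑ i ∈ legSet d P (Sum.inl l), legW d P (Sum.inl l) * f l (legPt P (Sum.inl l) w i) := rfl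

/-- [folklore] **THE SHIFT RULE ACROSS SCALES**: decimating the leg translated by `(P·N)•z′` on the fine lattice is the decimated leg translated by
`N•z′` on the coarse lattice (`legPt_add`). -/
theorem decLeg_shift (P N : ℕ) (f : Fin (d + 1) → Site (d + 1) → ℝ) (z' : Site (d + 1)) (l : Fin (d + 1)) (y : Site (d + 1)) :
    decLeg P (fun l z => f l (z - ((P * N : ℕ) : ℤ) • z')) l y = decLeg P f l (y - (N : ℤ) • z') := by
  simp only [decLeg]
  refine Finset.sum_congr rfl fun i _ => ?_
  have e : legPt P (Sum.inl l : Fib d) (y - (N : ℤ) • z') i = legPt P (Sum.inl l : Fib d) y i - ((P * N : ℕ) : ℤ) • z' := by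
    rw [sub_eq_add_neg, legPt_add, natCast_mul_smul, smul_neg, ← sub_eq_add_neg]
  rw [e]

/-- [folklore] **WHERE A LEG POINT SITS**: for a field-leg index `i` of the factor `P`, the `(P·N)`-block index of the leg point `legPt P (inl l) w i`
differs from the `N`-block index of `w` by at most one step in the leg direction: `|quo (P·N) (legPt P (inl l) w i) − quo N w|₁ ≤ 1`
(the point is `P•w + r + s e_l` with `0 ≤ r_j < P`, `0 ≤ s < P`, so its `P`-block index is `w` or `w + e_l`). -/
theorem l1_quo_legPt_sub_quo_le (P N : ℕ) [NeZero P] [NeZero N] (l : Fin (d + 1)) (w : Site (d + 1))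
    {i : (Fin (d + 1) → ℕ) × ℕ} (hi : i ∈ legSet d P (Sum.inl l)) :
    l1 (quo (P * N) (legPt P (Sum.inl l : Fib d) w i) - quo N w) ≤ 1 := by
  simp only [legSet, LegIdx, Finset.mem_product, Fintype.mem_piFinset, Finset.mem_range] at hi
  have hP : (0 : ℤ) < P := by exact_mod_cast Nat.pos_of_ne_zero (NeZero.ne P)
  have hN : (0 : ℤ) < N := by exact_mod_cast Nat.pos_of_ne_zero (NeZero.ne N)
  -- the offset `t` and its `P`-block index `ε`
  set t : Site (d + 1) := fun j => ((i.1 j : ℤ) + if j = l then (i.2 : ℤ) else 0) with ht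
  have hpt : legPt P (Sum.inl l : Fib d) w i = t + (P : ℤ) • w := by
    simp only [legPt, ht]; exact add_comm _ _
  have hq : quo (P * N) (legPt P (Sum.inl l : Fib d) w i) = quo N (w + quo P t) := by
    rw [quo_mul, hpt, quo_add_zsmul]
    exact congrArg (quo N) (add_comm _ _)
  -- coordinates of `ε = quo P t`: `0 ≤ ε j ≤ 1`, and `ε j = 0` off the leg direction
  have hε0 : ∀ j, 0 ≤ quo P t j := fun j => by
    simp only [quo, ht]
    refine Int.ediv_nonneg ?_ hP.le
    split_ifs <;> positivity
  have hε1 : ∀ j, quo P t j ≤ 1 := fun j => by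
    simp only [quo, ht]
    have h2 : ((i.1 j : ℤ) + if j = l then (i.2 : ℤ) else 0) < 2 * (P : ℤ) := by
      have a := hi.1 j; have b := hi.2
      split_ifs <;> omega
    have := Int.ediv_lt_iff_lt_mul hP |>.2 (by linarith : ((i.1 j : ℤ) + if j = l then (i.2 : ℤ) else 0) < 2 * (P : ℤ))
    omega
  have hεl : ∀ j, j ≠ l → quo P t j = 0 := fun j hj => by
    simp only [quo, ht, hj, if_false, add_zero]
    exact Int.ediv_eq_zero_of_lt (by positivity) (by exact_mod_cast hi.1 j)
  -- per coordinate: `0 ≤ (w j + ε j)/N − w j/N ≤ ε j`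
  have hc : ∀ j, |((((quo N (w + quo P t) - quo N w) j : ℤ)) : ℝ)| ≤ if j = l then 1 else 0 := by
    intro j
    have e : (quo N (w + quo P t) - quo N w) j = (w j + quo P t j) / (N : ℤ) - w j / (N : ℤ) := by
      simp only [quo, Pi.sub_apply, Pi.add_apply]
    rw [e]
    have lo : w j / (N : ℤ) ≤ (w j + quo P t j) / (N : ℤ) := Int.ediv_le_ediv hN (by linarith [hε0 j])
    have hi' : (w j + quo P t j) / (N : ℤ) ≤ w j / (N : ℤ) + 1 := by
      have h1 : (w j + quo P t j) / (N : ℤ) ≤ (w j + 1 * (N : ℤ)) / (N : ℤ) :=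
        Int.ediv_le_ediv hN (by have := hε1 j; have hN1 : (1 : ℤ) ≤ N := hN; nlinarith)
      rw [Int.add_mul_ediv_right _ _ hN.ne'] at h1
      exact h1
    by_cases hj : j = l
    · simp only [hj, if_true]
      subst hj
      rw [abs_le]
      constructor
      · have : (0 : ℝ) ≤ (((w j + quo P t j) / (N : ℤ) - w j / (N : ℤ) : ℤ) : ℝ) := by exact_mod_cast (by linarith)
        linarith
      · exact_mod_cast (by linarith : (w j + quo P t j) / (N : ℤ) - w j / (N : ℤ) ≤ 1)
    · simp only [hj, if_false]
      have h0 : quo P t j = 0 := hεl j hj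
      rw [h0, add_zero, sub_self]
      simp
  rw [hq]
  unfold B12Sec2to5.l1
  calc ∑ j, |((((quo N (w + quo P t) - quo N w) j : ℤ)) : ℝ)| ≤ ∑ j : Fin (d + 1), (if j = l then (1 : ℝ) else 0) :=
        Finset.sum_le_sum fun j _ => hc j
    _ = 1 := by rw [Finset.sum_ite_eq']; simp

/-- [folklore] **BLOCK-DECAY TRANSFER, ONE LEG POINT** (orientation `x − quo`): a leg bounded by `C·e^{−κ|x − quo (P·N) ·|₁}` is, at every `P`-leg point
over `w`, bounded by `C·e^{κ}·e^{−κ|x − quo N w|₁}`. -/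
theorem abs_leg_transfer (P N : ℕ) [NeZero P] [NeZero N] {f : Fin (d + 1) → Site (d + 1) → ℝ} {C κ : ℝ} (hκ : 0 ≤ κ)
    (x : Site (d + 1)) (hf : ∀ l w, |f l w| ≤ C * Real.exp (-κ * l1 (x - quo (P * N) w)))
    (l : Fin (d + 1)) (w : Site (d + 1)) {i : (Fin (d + 1) → ℕ) × ℕ} (hi : i ∈ legSet d P (Sum.inl l)) :
    |f l (legPt P (Sum.inl l : Fib d) w i)| ≤ C * Real.exp κ * Real.exp (-κ * l1 (x - quo N w)) := by
  have hC : 0 ≤ C := nonneg_of_dominated (Real.exp_pos _) (hf l w)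
  set q := quo (P * N) (legPt P (Sum.inl l : Fib d) w i) with hq
  have h1 : l1 (x - quo N w) ≤ l1 (x - q) + 1 :=
    (l1_sub_triangle x q (quo N w)).trans (by have := l1_quo_legPt_sub_quo_le P N l w hi; rw [← hq] at this; linarith)
  calc |f l (legPt P (Sum.inl l : Fib d) w i)| ≤ C * Real.exp (-κ * l1 (x - q)) := hf l _
    _ ≤ C * (Real.exp κ * Real.exp (-κ * l1 (x - quo N w))) := by
        refine mul_le_mul_of_nonneg_left ?_ hC
        rw [← Real.exp_add, Real.exp_le_exp]
        nlinarith
    _ = _ := by ring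

/-- [folklore] **BLOCK-DECAY TRANSFER, ONE LEG POINT** (orientation `quo − z`). -/
theorem abs_leg_transfer' (P N : ℕ) [NeZero P] [NeZero N] {f : Fin (d + 1) → Site (d + 1) → ℝ} {C κ : ℝ} (hκ : 0 ≤ κ)
    (z : Site (d + 1)) (hf : ∀ l w, |f l w| ≤ C * Real.exp (-κ * l1 (quo (P * N) w - z)))
    (l : Fin (d + 1)) (w : Site (d + 1)) {i : (Fin (d + 1) → ℕ) × ℕ} (hi : i ∈ legSet d P (Sum.inl l)) :
    |f l (legPt P (Sum.inl l : Fib d) w i)| ≤ C * Real.exp κ * Real.exp (-κ * l1 (quo N w - z)) := by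
  have hf' : ∀ l w, |f l w| ≤ C * Real.exp (-κ * l1 (z - quo (P * N) w)) := fun l w => by rw [l1_sub_symm]; exact hf l w
  rw [l1_sub_symm]
  exact abs_leg_transfer P N hκ z hf' l w hi

/-- [folklore] **BLOCK-DECAY TRANSFER OF THE DECIMATED LEG** (orientation `x − quo`; leaf-11-g15's (c)): if `|f l w| ≤ C·e^{−κ|x − quo (P·N) w|₁}` on the
fine lattice then `|decLeg P f l w̄| ≤ C·e^{κ}·e^{−κ|x − quo N w̄|₁}` on the coarse one (convexity: `legW ≥ 0`, `Σ legW = 1`). -/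
theorem abs_decLeg_le (P N : ℕ) [NeZero P] [NeZero N] {f : Fin (d + 1) → Site (d + 1) → ℝ} {C κ : ℝ} (hκ : 0 ≤ κ)
    (x : Site (d + 1)) (hf : ∀ l w, |f l w| ≤ C * Real.exp (-κ * l1 (x - quo (P * N) w))) (l : Fin (d + 1)) (w : Site (d + 1)) :
    |decLeg P f l w| ≤ C * Real.exp κ * Real.exp (-κ * l1 (x - quo N w)) := by
  rw [decLeg_apply]
  calc |∑ i ∈ legSet d P (Sum.inl l), legW d P (Sum.inl l) * f l (legPt P (Sum.inl l) w i)|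
      ≤ ∑ i ∈ legSet d P (Sum.inl l), |legW d P (Sum.inl l) * f l (legPt P (Sum.inl l) w i)| := Finset.abs_sum_le_sum_abs _ _
    _ ≤ ∑ i ∈ legSet d P (Sum.inl l), legW d P (Sum.inl l) * (C * Real.exp κ * Real.exp (-κ * l1 (x - quo N w))) := by
        refine Finset.sum_le_sum fun i hi => ?_
        rw [abs_mul, abs_of_nonneg (legW_nonneg P _)]
        exact mul_le_mul_of_nonneg_left (abs_leg_transfer P N hκ x hf l w hi) (legW_nonneg P _)
    _ = _ := by rw [← Finset.sum_mul, sum_legW (NeZero.ne P), one_mul]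

/-- [folklore] **BLOCK-DECAY TRANSFER OF THE DECIMATED LEG** (orientation `quo − z`). -/
theorem abs_decLeg_le' (P N : ℕ) [NeZero P] [NeZero N] {f : Fin (d + 1) → Site (d + 1) → ℝ} {C κ : ℝ} (hκ : 0 ≤ κ)
    (z : Site (d + 1)) (hf : ∀ l w, |f l w| ≤ C * Real.exp (-κ * l1 (quo (P * N) w - z))) (l : Fin (d + 1)) (w : Site (d + 1)) :
    |decLeg P f l w| ≤ C * Real.exp κ * Real.exp (-κ * l1 (quo N w - z)) := by
  have hf' : ∀ l w, |f l w| ≤ C * Real.exp (-κ * l1 (z - quo (P * N) w)) := fun l w => by rw [l1_sub_symm]; exact hf l w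
  rw [l1_sub_symm]
  exact abs_decLeg_le P N hκ z hf' l w

end DecLeg

/-! ## §3 The adjointness of the lift and the leg decimation inside the sandwich nesting -/

section Adjoint

variable (P : ℕ) [NeZero P]

/-- [folklore] **THE LIFT IS ADJOINT TO THE LEG DECIMATION** (the sandwich analogue of `InterLevelTransport.tadpole_avgLift`).  For ANY fine table
`S : MKer (d+1) (Fib d)` and outer legs `A`, `B`:
`Σ'_y Σ_{l′} (Σ'_w Σ_l A l w · avgLift P S w y (inl l) (inl l′)) · B l′ y = Σ'_ȳ Σ_{l′} (Σ'_w̄ Σ_l decLeg P A l w̄ · S w̄ ȳ (inl l) (inl l′)) · decLeg P B l′ ȳ`.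
Mechanism: unfold `avgLift P` (a finite sum over pairs of leg indices of residue-class conditions), exchange the two lattice `tsum`s with these FINITE
sums, re-index each residue class along `w̄ ↦ P•w̄ + legOff` (`tsum_sublattice`, unconditional) and re-assemble the leg-index sums into `decLeg`.
Hypotheses (SMALL side only): `hW` — for every leg index, the `w̄`-family `A l (legPt P (inl l) w̄ i) · S w̄ ȳ l l′` is summable (finite support in every
use); `hY` — for every leg index, the `ȳ`-family `(Σ'_w̄ Σ_l decLeg P A l w̄ · S w̄ ȳ l l′) · B l′ (legPt P (inl l′) ȳ i′)` is summable
(`TaylorSandwich.sandwich_summable` in every use; see `sandwich_decimate_of_legs`). -/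
theorem lift_adjoint_decLeg (A B : Fin (d + 1) → Site (d + 1) → ℝ) (S : MKer (d + 1) (Fib d))
    (hW : ∀ (l : Fin (d + 1)) (i : (Fin (d + 1) → ℕ) × ℕ), i ∈ legSet d P (Sum.inl l) → ∀ (y' : Site (d + 1)) (l' : Fin (d + 1)),
      Summable fun w' : Site (d + 1) => A l (legPt P (Sum.inl l) w' i) * S w' y' (Sum.inl l) (Sum.inl l'))
    (hY : ∀ (l' : Fin (d + 1)) (i' : (Fin (d + 1) → ℕ) × ℕ), i' ∈ legSet d P (Sum.inl l') →
      Summable fun y' : Site (d + 1) =>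
        (∑' w', ∑ l, decLeg P A l w' * S w' y' (Sum.inl l) (Sum.inl l')) * B l' (legPt P (Sum.inl l') y' i')) :
    ∑' y, ∑ l', (∑' w, ∑ l, A l w * avgLift P S w y (Sum.inl l) (Sum.inl l')) * B l' y =
      ∑' y', ∑ l', (∑' w', ∑ l, decLeg P A l w' * S w' y' (Sum.inl l) (Sum.inl l')) * decLeg P B l' y' := by
  -- the small inner object
  set X : Site (d + 1) → Fin (d + 1) → ℝ := fun y' l' => ∑' w', ∑ l, decLeg P A l w' * S w' y' (Sum.inl l) (Sum.inl l') with hX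
  -- (X-eq) `X` as the leg-indexed sum of re-indexed pieces
  have hXe : ∀ y' l', X y' l' = ∑ l, ∑ i ∈ legSet d P (Sum.inl l), legW d P (Sum.inl l) *
      ∑' w', A l (legPt P (Sum.inl l) w' i) * S w' y' (Sum.inl l) (Sum.inl l') := by
    intro y' l'
    have hs : ∀ l, ∀ i ∈ legSet d P (Sum.inl l), Summable fun w' : Site (d + 1) =>
        legW d P (Sum.inl l) * (A l (legPt P (Sum.inl l) w' i) * S w' y' (Sum.inl l) (Sum.inl l')) :=
      fun l i hi => (hW l i hi y' l').mul_left _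
    simp only [hX, decLeg, Finset.sum_mul]
    rw [Summable.tsum_finsetSum (fun l _ => summable_sum fun i hi => (hs l i hi).congr fun w' => by ring)]
    refine Finset.sum_congr rfl fun l _ => ?_
    rw [Summable.tsum_finsetSum (fun i hi => (hs l i hi).congr fun w' => by ring)]
    refine Finset.sum_congr rfl fun i hi => ?_
    rw [← tsum_mul_left]
    exact tsum_congr fun w' => by ring
  -- (I-eq) the big inner object, residue class by residue class
  have hI : ∀ y l', (∑' w, ∑ l, A l w * avgLift P S w y (Sum.inl l) (Sum.inl l')) =
      ∑ i' ∈ legSet d P (Sum.inl l'), legW d P (Sum.inl l') *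
        (if Torus.proj P (y - legOff P (Sum.inl l') i') = 0 then X (quo P (y - legOff P (Sum.inl l') i')) l' else 0) := by
    intro y l'
    -- the pieces
    set g : Fin (d + 1) → ((Fin (d + 1) → ℕ) × ℕ) → ((Fin (d + 1) → ℕ) × ℕ) → Site (d + 1) → ℝ :=
      fun l i i' w' => A l (legPt P (Sum.inl l) w' i) * S w' (quo P (y - legOff P (Sum.inl l') i')) (Sum.inl l) (Sum.inl l') with hg
    set F : Fin (d + 1) → ((Fin (d + 1) → ℕ) × ℕ) → ((Fin (d + 1) → ℕ) × ℕ) → Site (d + 1) → ℝ :=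
      fun l i i' w => legW d P (Sum.inl l') *
        (if Torus.proj P (y - legOff P (Sum.inl l') i') = 0 then
          legW d P (Sum.inl l) * (if Torus.proj P (w - legOff P (Sum.inl l) i) = 0 then g l i i' (quo P (w - legOff P (Sum.inl l) i)) else 0)
        else 0) with hF
    -- termwise expansion of the lift
    have e1 : ∀ w l, A l w * avgLift P S w y (Sum.inl l) (Sum.inl l') =
        ∑ i ∈ legSet d P (Sum.inl l), ∑ i' ∈ legSet d P (Sum.inl l'), F l i i' w := by
      intro w l
      simp only [avgLift, Finset.mul_sum, hF, hg]
      refine Finset.sum_congr rfl fun i _ => Finset.sum_congr rfl fun i' _ => ?_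
      by_cases hy : Torus.proj P (y - legOff P (Sum.inl l') i') = 0
      · by_cases hw : Torus.proj P (w - legOff P (Sum.inl l) i) = 0
        · simp only [hw, hy, and_self, if_true]
          rw [legPt_eq_add_legOff, eq_zsmul_quo_add_off hw]
          ring
        · simp [hw, hy]
      · simp [hy]
    -- summability of every piece in `w`
    have hFs : ∀ l, ∀ i ∈ legSet d P (Sum.inl l), ∀ i', Summable (F l i i') := by
      intro l i hi i'
      by_cases hy : Torus.proj P (y - legOff P (Sum.inl l') i') = 0
      · simp only [hF, hy, if_true]
        exact ((summable_sublattice P (legOff P (Sum.inl l) i) (hW l i hi _ l')).mul_left _).mul_left _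
      · simp only [hF, hy, if_false, mul_zero]
        exact summable_zero
    -- the `w`-sum of every piece
    have hFt : ∀ l, ∀ i ∈ legSet d P (Sum.inl l), ∀ i', ∑' w, F l i i' w = legW d P (Sum.inl l') *
        (if Torus.proj P (y - legOff P (Sum.inl l') i') = 0 then legW d P (Sum.inl l) * ∑' w', g l i i' w' else 0) := by
      intro l i hi i'
      by_cases hy : Torus.proj P (y - legOff P (Sum.inl l') i') = 0
      · simp only [hF, hy, if_true]
        rw [tsum_mul_left, tsum_mul_left, tsum_sublattice P (legOff P (Sum.inl l) i) (g l i i')]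
      · simp only [hF, hy, if_false, mul_zero, tsum_zero]
    calc (∑' w, ∑ l, A l w * avgLift P S w y (Sum.inl l) (Sum.inl l'))
        = ∑' w, ∑ l, ∑ i ∈ legSet d P (Sum.inl l), ∑ i' ∈ legSet d P (Sum.inl l'), F l i i' w :=
          tsum_congr fun w => Finset.sum_congr rfl fun l _ => e1 w l
      _ = ∑ l, ∑ i ∈ legSet d P (Sum.inl l), ∑ i' ∈ legSet d P (Sum.inl l'), ∑' w, F l i i' w := by
          rw [Summable.tsum_finsetSum (fun l _ => summable_sum fun i hi => summable_sum fun i' _ => hFs l i hi i')]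
          refine Finset.sum_congr rfl fun l _ => ?_
          rw [Summable.tsum_finsetSum (fun i hi => summable_sum fun i' _ => hFs l i hi i')]
          refine Finset.sum_congr rfl fun i hi => ?_
          exact Summable.tsum_finsetSum fun i' _ => hFs l i hi i'
      _ = ∑ l, ∑ i ∈ legSet d P (Sum.inl l), ∑ i' ∈ legSet d P (Sum.inl l'), legW d P (Sum.inl l') *
          (if Torus.proj P (y - legOff P (Sum.inl l') i') = 0 then legW d P (Sum.inl l) * ∑' w', g l i i' w' else 0) :=
          Finset.sum_congr rfl fun l _ => Finset.sum_congr rfl fun i hi => Finset.sum_congr rfl fun i' _ => hFt l i hi i'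
      _ = ∑ i' ∈ legSet d P (Sum.inl l'), ∑ l, ∑ i ∈ legSet d P (Sum.inl l), legW d P (Sum.inl l') *
          (if Torus.proj P (y - legOff P (Sum.inl l') i') = 0 then legW d P (Sum.inl l) * ∑' w', g l i i' w' else 0) := by
          rw [Finset.sum_comm]
          refine (Finset.sum_congr rfl fun l _ => Finset.sum_comm).trans ?_
          rw [Finset.sum_comm]
      _ = _ := by
          refine Finset.sum_congr rfl fun i' _ => ?_
          by_cases hy : Torus.proj P (y - legOff P (Sum.inl l') i') = 0
          · simp only [hy, if_true]
            rw [hXe]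
            simp only [hg, Finset.mul_sum]
          · simp only [hy, if_false, mul_zero, Finset.sum_const_zero]
  -- (outer) the `y`-sum, residue class by residue class
  set h : Fin (d + 1) → ((Fin (d + 1) → ℕ) × ℕ) → Site (d + 1) → ℝ :=
    fun l' i' y' => X y' l' * B l' (legPt P (Sum.inl l') y' i') with hh
  set H : Fin (d + 1) → ((Fin (d + 1) → ℕ) × ℕ) → Site (d + 1) → ℝ :=
    fun l' i' y => legW d P (Sum.inl l') *
      (if Torus.proj P (y - legOff P (Sum.inl l') i') = 0 then h l' i' (quo P (y - legOff P (Sum.inl l') i')) else 0) with hH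
  have e2 : ∀ y l', (∑' w, ∑ l, A l w * avgLift P S w y (Sum.inl l) (Sum.inl l')) * B l' y =
      ∑ i' ∈ legSet d P (Sum.inl l'), H l' i' y := by
    intro y l'
    rw [hI, Finset.sum_mul]
    refine Finset.sum_congr rfl fun i' _ => ?_
    simp only [hH, hh]
    by_cases hy : Torus.proj P (y - legOff P (Sum.inl l') i') = 0
    · simp only [hy, if_true]
      rw [legPt_eq_add_legOff, eq_zsmul_quo_add_off hy]
      ring
    · simp only [hy, if_false, mul_zero, zero_mul]
  have hHs : ∀ l', ∀ i' ∈ legSet d P (Sum.inl l'), Summable (H l' i') := by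
    intro l' i' hi'
    simp only [hH]
    exact (summable_sublattice P (legOff P (Sum.inl l') i') (hY l' i' hi')).mul_left _
  have hHt : ∀ l', ∀ i' ∈ legSet d P (Sum.inl l'), ∑' y, H l' i' y = legW d P (Sum.inl l') * ∑' y', h l' i' y' := by
    intro l' i' hi'
    simp only [hH]
    rw [tsum_mul_left, tsum_sublattice P (legOff P (Sum.inl l') i') (h l' i')]
  have hhs : ∀ l', ∀ i' ∈ legSet d P (Sum.inl l'), Summable fun y' => legW d P (Sum.inl l') * h l' i' y' :=
    fun l' i' hi' => (hY l' i' hi').mul_left _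
  calc ∑' y, ∑ l', (∑' w, ∑ l, A l w * avgLift P S w y (Sum.inl l) (Sum.inl l')) * B l' y
      = ∑' y, ∑ l', ∑ i' ∈ legSet d P (Sum.inl l'), H l' i' y := tsum_congr fun y => Finset.sum_congr rfl fun l' _ => e2 y l'
    _ = ∑ l', ∑ i' ∈ legSet d P (Sum.inl l'), ∑' y, H l' i' y := by
        rw [Summable.tsum_finsetSum (fun l' _ => summable_sum fun i' hi' => hHs l' i' hi')]
        exact Finset.sum_congr rfl fun l' _ => Summable.tsum_finsetSum fun i' hi' => hHs l' i' hi'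
    _ = ∑ l', ∑ i' ∈ legSet d P (Sum.inl l'), ∑' y', legW d P (Sum.inl l') * h l' i' y' := by
        refine Finset.sum_congr rfl fun l' _ => Finset.sum_congr rfl fun i' hi' => ?_
        rw [hHt l' i' hi', tsum_mul_left]
    _ = ∑' y', ∑ l', ∑ i' ∈ legSet d P (Sum.inl l'), legW d P (Sum.inl l') * h l' i' y' := by
        rw [Summable.tsum_finsetSum (fun l' _ => summable_sum fun i' hi' => hhs l' i' hi')]
        exact Finset.sum_congr rfl fun l' _ => (Summable.tsum_finsetSum fun i' hi' => hhs l' i' hi').symm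
    _ = _ := by
        refine tsum_congr fun y' => Finset.sum_congr rfl fun l' _ => ?_
        change ∑ i' ∈ legSet d P (Sum.inl l'), legW d P (Sum.inl l') * (X y' l' * B l' (legPt P (Sum.inl l') y' i')) =
          X y' l' * decLeg P B l' y'
        rw [decLeg_apply, Finset.mul_sum]
        exact Finset.sum_congr rfl fun i' _ => by ring

end Adjoint

end Summit.QuantumFields.BalabanUV.Beta.GAN24.SandwichDecimate
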